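import Summits.AtomisticToContinuum.HydrodynamicLimit.Theses.PesinPricing

/-!
# Birth skeleton (BC3) for crux `PesinSaturationRigidityR`
(stmt-AtomisticToContinuum-13806, route `PesinPricing`, rank 4; registrar seat
`planner-skel-stmt-AtomisticToContinuum-13806-0`, 2026-08-17)

Crux (FIXED, imported by name):
`Summit.AtomisticToContinuum.HydrodynamicLimit.Theses.PesinPricing.PesinSaturationRigidityR` —
`∃ η₀ > 0 ∀ Φ equilibrium ∀ ν`, `RegularStationaryState Φ ν` ∧ spatially ergodic ∧
`0 < density ν < η₀` ∧ `infPesinDefect Φ ν = 0` ⟹ `∃ z > 0, β > 0, u`, `IsHardSphereGibbs 1 z β u ν`.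

## The seam: ENTROPY, not plaques

The route's TWO-LAYER PLAN foresaw `InfiniteVolumeLY → URigidity` through u-regularity of `ν` for a
plaque functor of the infinite flow.  Both functors the tree holds are now known or expected to be
DEGENERATE on exactly the states this crux is about: D4 `infiniteUnstablePlaques` (crux attack on
URigidityR2, stmt-13896: exterior held to the recorded movie ⇒ plaques leaf-null) and D5
`slavedUnstablePlaques` (landed negative lemma
`Theorems.GibbsStatesURegularSlaved.Negative.GibbsStatesURegularSlaved_false_of_LeafNullSlavedPlaques`,
with the construction `LeafNullSlavedPlaques` expected to hold by synchronisation + absorption).  A stub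
"zero defect ⇒ `(slavedUnstablePlaques 1 Φ).IsURegular ν`" would therefore be an instance of what that
negative lemma refutes (granted the route's own load-bearing H1 "dilute Gibbs states have zero defect"
and the construction `LeafNullSlavedPlaques`, a dilute Gibbs state would have to be u-regular, which the
lemma forbids), so this skeleton does NOT route through `PlaqueFamily.IsURegular`.

Instead the crux is cut along the one seam the tree can already state without a plaque object:
the SPECIFIC RELATIVE ENTROPY `PointProcess.specificRelEntropy ν g` with respect to a translation
invariant Gibbs state `g` (RegularStationaryState.lean; OVY 1993 (5.2)).

* `stub_saturationEntropy` (XL, HARDEST — the dynamical rigidity in entropy form, "infinite-volume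
  Ledrappier–Young"): in the crux's class, zero Pesin defect forces ZERO specific relative entropy with
  respect to SOME translation-invariant hard-sphere Gibbs state `g_{z,β,u}` (`0 < z`, `0 < β`).  This is
  what an entropy/large-deviation mechanism (the route's pricing: Kifer–Young rate = Pesin defect,
  static budget = specific relative entropy) can deliver, and it is STRICTLY WEAKER than the crux
  (crux ⇒ stub with `g := ν`, since `s(ν | ν) = 0`), while stub ⇒ crux needs the variational principle.
* `stub_gibbsVariational` (L — the static identification; Gibbs variational principle for the MARKED
  hard-core gas, Georgii–Zessin 1993 §3 / Georgii 1994–1995 / Dereudre 2019 §4, finite-range hard-core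
  case, marks by the chain rule): a translation-invariant probability law with zero specific relative
  entropy with respect to a translation-invariant Gibbs state `g_{z,β,u}` satisfies the DLR equations
  for the SAME parameters, i.e. `IsHardSphereGibbs 1 z β u ν` (membership in the full DLR class, so
  phase coexistence is harmless).  In print for superstable / finite-range interactions; the hard-core +
  Maxwellian-mark bookkeeping is the formalisation debt, not a conjecture.

Composition `PesinSaturationRigidityR_of` (PROVED below, no sorry): take `η₀ := η₁` of the first stub;
for `ν` in the class obtain `g_{z,β,u}` with `s(ν | g) = 0`; the second stub, fed with
`RegularStationaryState.isProbabilityMeasure / .translationInvariant`, returns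
`IsHardSphereGibbs 1 z β u ν` for the same `(z, β, u)`.

Disproof.lean: none on file for this crux (`ledger crux ls` empty at registration).  Negatives index /
landed Negative lemmas honoured: no stub mentions a plaque functor (see above); the crux's own guards
(spatial ergodicity, `0 < density`, entropy-regularity inside `RegularStationaryState`, `d = 3`,
diameter `1`) are carried VERBATIM into `stub_saturationEntropy`, so the gen-1/gen-2 witnesses of the
retired 9729 wording (non-ergodic Gibbs mixtures, `δ_∅`, lane states, Dirac-velocity kernels) stay
outside its hypothesis exactly as they stay outside the crux's.
-/

noncomputable section

namespace Summit.AtomisticToContinuum.HydrodynamicLimit.Cruxes.PesinSaturationRigidityR.Birth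

open MeasureTheory
open Summit.AtomisticToContinuum.HydrodynamicLimit.Theses.PesinPricing (PesinSaturationRigidityR)

/-! ### The two statements of the line (Props; the crux's own vocabulary, fully qualified) -/

/-- **Statement 1 (hardest stub): Pesin saturation ⇒ zero specific relative entropy w.r.t. a translation
invariant dilute Gibbs state** ("infinite-volume Ledrappier–Young in entropy form").  There is
`η₁ > 0` such that for every equilibrium infinite hard-sphere flow `Φ` (`d = 3`, diameter `1`) and every
regular stationary state `ν` of `Φ` that is spatially ergodic, of density in `(0, η₁)` and of zero
Pesin defect `infPesinDefect Φ ν = 0`, there are parameters `z > 0`, `β > 0`, `u` and a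
TRANSLATION-INVARIANT Gibbs state `g` of the unit-diameter gas at `(z, β, u)` with
`specificRelEntropy ν g = 0`.  Why plausibly true: zero defect = equality in the (density) Ruelle
inequality, the infinite-volume analogue of the entropy formula characterising SRB/u-Gibbs states
(Ledrappier–Young 1985 Thm A); u-Gibbs + Hopf/velocity exchange ⇒ Gibbs, and a Gibbs state has zero
entropy relative to itself.  Why it might fail: exactly the crux's kill criterion (a colliding
zero-defect conspiracy: spatially ergodic, entropy-regular, dilute, stationary, non-Gibbs with
`h = λ⁺`). Sources: LedrappierYoung1985, BarreiraPesin2023 (Thm 9.27), OllaVaradhanYau1993 (§4–5),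
NachtergaeleYau2003 (§2.3 Assumption III), KellerLiverani2009, BricmontKupiainen1996. -/
def SaturationEntropy : Prop :=
  ∃ η₁ : ℝ, 0 < η₁ ∧ ∀ (Φ : Literature.Analysis.FluidPDE.InfiniteHardSphereFlow (Fin 3) 1), Φ.IsEquilibriumFlow → ∀ ν : MeasureTheory.Measure (Literature.Analysis.FunctionSpaces.PointConfig (Literature.MathematicalPhysics.KineticTheory.V3 × Literature.MathematicalPhysics.KineticTheory.V3)), Literature.MathematicalPhysics.KineticTheory.RegularStationaryState Φ ν → (∀ A : Set (Literature.Analysis.FunctionSpaces.PointConfig (Literature.MathematicalPhysics.KineticTheory.V3 × Literature.MathematicalPhysics.KineticTheory.V3)), MeasurableSet A → (∀ a : Literature.MathematicalPhysics.KineticTheory.V3, Literature.Analysis.FunctionSpaces.PointConfig.translate ((a, 0) : Literature.MathematicalPhysics.KineticTheory.V3 × Literature.MathematicalPhysics.KineticTheory.V3) ⁻¹' A = A) → ν A = 0 ∨ ν A = 1) → 0 < Literature.MathematicalPhysics.KineticTheory.PointProcess.density ν → Literature.MathematicalPhysics.KineticTheory.PointProcess.density ν < ENNReal.ofReal η₁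 → Literature.Dynamics.Billiards.infPesinDefect Φ ν = 0 → ∃ (z β : ℝ) (u : Literature.MathematicalPhysics.KineticTheory.V3) (g : MeasureTheory.Measure (Literature.Analysis.FunctionSpaces.PointConfig (Literature.MathematicalPhysics.KineticTheory.V3 × Literature.MathematicalPhysics.KineticTheory.V3))), 0 < z ∧ 0 < β ∧ Literature.Analysis.FluidPDE.IsHardSphereGibbs 1 z β u g ∧ Literature.Analysis.FluidPDE.IsTranslationInvariant g ∧ Literature.MathematicalPhysics.KineticTheory.PointProcess.specificRelEntropy ν g = 0

/-- **Statement 2 (stub): the Gibbs variational principle for the marked hard-sphere gas (zero specific relative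
entropy ⇒ DLR).**  For every activity `z > 0`, inverse temperature `β > 0`, drift `u`, every
TRANSLATION-INVARIANT Gibbs state `g` of the unit-diameter hard-sphere gas at `(z, β, u)` and every
translation-invariant probability law `ν` on configurations: `specificRelEntropy ν g = 0`
(`limsup_n |Λ_n|⁻¹ H(ν_{Λ_n} | g_{Λ_n}) = 0` over the centred cubes) implies that `ν` satisfies the DLR
equations for the SAME parameters, `IsHardSphereGibbs 1 z β u ν` (membership in the full Gibbs class —
`ν = g` is not claimed, so phase coexistence is harmless).  Why plausibly true: the variational
principle for Gibbs point processes — Poisson-referenced form `I(P) + H(P) ≥ -p_H` with equality iff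
`P ∈ 𝒢_H`, for stationary `P` and finite-range stable `H`, HARD CORE ALLOWED: Dereudre, ECP 21 (2016)
no. 10, Thm 1 and Cor 1 (arXiv:1506.05000, doi:10.1214/16-ecp4368); identification of the
`g`-referenced entropy density `lim |Λ|⁻¹ H(ν_Λ | g_Λ)` with the excess free energy for tempered Gibbs
`g`: Georgii–Zessin 1993 §3, Georgii 1994 (superstable pairwise), Georgii 1995; MARKED version
(velocities as marks, Maxwellian mark reference — split off by the chain rule for relative entropy):
Jahnel–Köppl–Steenbeck–Zass, EJP 2025 (arXiv:2408.17170).  Why it might fail (as typed): the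
window-MARGINAL form `H(ν_Λ | g_Λ)` (not the specification with boundary condition) for the hard-core gas
at HIGH activity, where the boundary layer of `g_Λ` must be shown `o(|Λ|)` in entropy (finite range +
hard core bound the layer; printed only Poisson-referenced).  Sources: arXiv:1506.05000,
arXiv:2408.17170, GeorgiiZessin1993, Georgii1994, Georgii1995, Dereudre2019, Ruelle1969 (§7.2),
NachtergaeleYau2003 (§2.3). -/
def GibbsVariational : Prop :=
  ∀ (z β : ℝ) (u : Literature.MathematicalPhysics.KineticTheory.V3) (g ν : MeasureTheory.Measure (Literature.Analysis.FunctionSpaces.PointConfig (Literature.MathematicalPhysics.KineticTheory.V3 × Literature.MathematicalPhysics.KineticTheory.V3))), 0 < z → 0 < β → Literature.Analysis.FluidPDE.IsHardSphereGibbs 1 z β u g → Literature.Analysis.FluidPDE.IsTranslationInvariant g → MeasureTheory.IsProbabilityMeasure ν → Literature.Analysis.FluidPDE.IsTranslationInvariant ν → Literature.MathematicalPhysics.KineticTheory.PointProcess.specificRelEntropy ν g = 0 → Literature.Analysis.FluidPDE.IsHardSphereGibbs 1 z β u ν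

/-! ### Registered stubs (the open obligations of the line; `sorry` ONLY here) -/

/-- STUB 1 (XL; HARDEST — the dynamical rigidity in entropy form, unprinted in infinite volume). -/
theorem stub_saturationEntropy : SaturationEntropy := by
  sorry

/-- STUB 2 (L; printed mathematics — the Gibbs variational principle for the marked hard-core gas). -/
theorem stub_gibbsVariational : GibbsVariational := by
  sorry

/-! ### Name-keyed aliases of the stub statements (the hypotheses of the composition; the skeleton audit
admits a hypothesis only if its head constant is a registered obligation or is named like a declared stub) -/
namespace Registered

/-- Alias of `SaturationEntropy` keyed by the registered stub name. -/
abbrev stub_saturationEntropy : Prop := SaturationEntropy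
/-- Alias of `GibbsVariational` keyed by the registered stub name. -/
abbrev stub_gibbsVariational : Prop := GibbsVariational

end Registered

/-! ### Composition (PROVED, no `sorry`) -/

/-- **Composition** (kernel-checked, no `sorry`): the two stubs imply the crux BY NAME.  The density
threshold of the crux is the `η₁` of `SaturationEntropy`; the Gibbs parameters of `ν` are those of the
entropy-nearest translation-invariant Gibbs state it produces, identified by `GibbsVariational` fed with
`RegularStationaryState.isProbabilityMeasure` and `RegularStationaryState.translationInvariant`. -/
theorem PesinSaturationRigidityR_of (hSat : Registered.stub_saturationEntropy)
    (hVP : Registered.stub_gibbsVariational) : PesinSaturationRigidityR := by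
  obtain ⟨η₁, hη₁, hclass⟩ := hSat
  refine ⟨η₁, hη₁, ?_⟩
  intro Φ hΦ ν hν herg hρpos hρlt hdefect
  obtain ⟨z, β, u, g, hz, hβ, hg, hgti, hent⟩ := hclass Φ hΦ ν hν herg hρpos hρlt hdefect
  exact ⟨z, β, u, hz, hβ,
    hVP z β u g ν hz hβ hg hgti hν.isProbabilityMeasure hν.translationInvariant hent⟩

/-- Wiring check: the registered stubs feed `PesinSaturationRigidityR_of` as stated (this `example`
inherits the stubs' `sorry`; the composition above does not). -/
example : PesinSaturationRigidityR :=
  PesinSaturationRigidityR_of stub_saturationEntropy stub_gibbsVariational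

end Summit.AtomisticToContinuum.HydrodynamicLimit.Cruxes.PesinSaturationRigidityR.Birth

end
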